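import Summits.ResolutionOfSingularities.ResolutionOfSingularities.Theorems.TightCutWitness
import HarnessLib

/-!
# TightCutCharts — decomp-res node «TightCut» (lens-3 g17), tree file 3/7: §J₂.6 (first half) reading the
cone law of move `t+2` chart by
chart — the face structure of the cubic layer of `F_{t+2}` and the chart exclusions.  PROVED, 0 sorry.

Content VERBATIM from the decomp-res lens-3 g17 file `HOME/decomp-res-lens-3/g17/TightCut.lean` (sha256
7fe2fb69bd2eaf82, 3149 l;
HOME = run/shared/lean/pub/decomp-res).  Critic: CRITIC-LEDGER row 136 CLEARED, landing order 2026-08-30T19:49:35Z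
(after node «ShadeCut» =
`Theorems/ShadeCutLawJ`, `ShadeCutTailTwo`, `ShadeCutShadeTwo`, `MaxContactCutShadeCut`).

[WRITER NOTE (decomp-res writer g7): the lens's carried VERBATIM copies §V1/§V2 (g15 ConeCut calculus),
§J/§S/§K/§L/§M (g16 ShadeCut) are
DELETED in favour of the landed `Theorems/ConeCut*`, `ConeCutAxisLaw`, `FloorCutFloor`, `ShadeCut*`,
`MaxContactCutShadeCut` (imported and
opened; `exists_third`/`exists_ne` now the tree's `ConeCut.exists_third` / `FloorCut.exists_ne`); the by-name
`closes` re-export (§M) is not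
restated; g16's `fin3_enum` (dedup of a Literature triviality) becomes a proof-local `have … := by decide` in `prod_three`.  NEW content only, split by the lens's own sections (400-line file limit): `TightCutLawJ2` (§J₂.1–§J₂.3), `TightCutWitness`
(§J₂.4–§J₂.5), `TightCutCharts` + `TightCutCharts2` (§J₂.6), `TightCutPoverty` (§P), `TightCutClasses`
(cone-free: the two §K3 classes, home of
the aside), `MaxContactCutTightCut` (Theses cone: §K3 theorems + §L4 + §N).  ONE namespace `…Theorems.TightCut`
as in the lens; global
`set_option` line dropped; nothing else changed.]
(Sources: CossartPiltant2008 Prop. 4.2; CossartPiltant2009; CossartJannsenSaito2020; Hauser2010; Moh1987;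
HauserPerlega2019; BenitoVillamayor2012; Cutkosky2009 Thm. 5.1.)
-/

noncomputable section

open MvPolynomial Finset
open Literature.AlgebraicGeometry.Resolution
open Literature.AlgebraicGeometry.Resolution.Hauser2010
open Literature.AlgebraicGeometry.Resolution.PointBlowup
open Summit.ResolutionOfSingularities.ResolutionOfSingularities.Theses
open Summit.ResolutionOfSingularities.ResolutionOfSingularities.Theorems.TightDefectClasses
open Summit.ResolutionOfSingularities.ResolutionOfSingularities.Theorems.TightDefectStrongWalks
open Summit.ResolutionOfSingularities.ResolutionOfSingularities.Theorems.ItineraryCutClasses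
open Summit.ResolutionOfSingularities.ResolutionOfSingularities.Theorems.BoundaryLedger
open Summit.ResolutionOfSingularities.ResolutionOfSingularities.Theorems.ProximityCut
open Summit.ResolutionOfSingularities.ResolutionOfSingularities.Theorems.ConeCutAxisLaw
open Literature.AlgebraicGeometry.Resolution.WeightedBlowup
open Literature.Barriers.ResolutionOfSingularities
open Summit.ResolutionOfSingularities.ResolutionOfSingularities.Theorems.FloorCut
open Summit.ResolutionOfSingularities.ResolutionOfSingularities.Theorems.ConeCut
open Summit.ResolutionOfSingularities.ResolutionOfSingularities.Theorems.ExitLaw (fin3_cases)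
open Summit.ResolutionOfSingularities.ResolutionOfSingularities.Theorems.ShadeCut

namespace Summit.ResolutionOfSingularities.ResolutionOfSingularities.Theorems.TightCut

section LawJ2Charts

variable {K : Type} [Field K] [DecidableEq K] {q : ℕ} {s₀ : State (Fin 3) K}

/-! ### §J₂.6 Reading the cone law of move `t+2`, chart by chart -/

omit [DecidableEq K] in
/-- **Taylor coefficients of a translated polynomial**, termwise over the support. [folklore] -/
theorem coeff_translate_eq_sum (b : Fin 3 → K) (R : MvPolynomial (Fin 3) K) (D : Fin 3 →₀ ℕ) :
    coeff D (translate b R) = ∑ E ∈ R.support, coeff E R * ∏ x, (((E x).choose (D x) : K) * b x ^ (E x - D x)) := by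
  conv_lhs => rw [R.as_sum, translate_finset_sum, coeff_sum]
  exact Finset.sum_congr rfl fun E _ => coeff_translate_monomial b E D _

omit [DecidableEq K] in
/-- The residual layer does not involve the chart variable. [folklore] -/
theorem coeff_resLayer_eq_zero_of_ne (l : Fin 3) (s : State (Fin 3) K) (o : ℕ) {E : Fin 3 →₀ ℕ} (hE : E l ≠ 0) :
    coeff E (resLayer l s o) = 0 := by
  classical
  unfold resLayer
  rw [coeff_sum]
  refine Finset.sum_eq_zero fun d _ => ?_
  rw [coeff_monomial, if_neg]
  intro heq
  rw [← heq, update_apply', if_pos rfl] at hE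
  exact hE rfl

/-- The kept mass of an untranslated move is everything off the chart. [folklore] -/
theorem kept_degree_of_untranslated (W : ForcedWalk q s₀) (t : ℕ) (hb : W.b t = 0) :
    (kept W t).degree + (W.st t).r (W.j t) = (W.st t).r.degree := by
  obtain ⟨a, ha⟩ := FloorCut.exists_ne (W.j t)
  obtain ⟨c, hca, hcj⟩ := exists_third ha
  have hka : kept W t a = (W.st t).r a := by rw [kept_of_ne W t ha, if_pos (by rw [hb]; rfl)]
  have hkc : kept W t c = (W.st t).r c := by rw [kept_of_ne W t hcj, if_pos (by rw [hb]; rfl)]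
  have hkj := kept_chart W t
  rw [degree_eq_three (kept W t) ha hca hcj, degree_eq_three (W.st t).r ha hca hcj]
  omega

namespace TightRepeat

variable {W : ForcedWalk q s₀} {t : ℕ} {k : Fin 3}

/-- **MOVE `t+2` IS TRANSLATED.**  If `b_{t+2} = 0`, one of the two witnesses of `F_{t+2}` has positive exponent above
the boundary at the chart variable `l = j_{t+2}` (`u_k^3` if `l = k`, `u_i^2 u_j` otherwise), and its chart image has
degree `< o_{t+3} = 2 o_{t+2} − q − r_{t+2}(l)`: the shade drops at `t+3`. [new] [folklore] -/
theorem untranslated_false (hroot : IsRoot q s₀) (h : TightRepeat W t k) (hb : W.b (t + 2) = 0) : False := by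
  classical
  obtain ⟨o₀, o₁, o₂, ho₀, ho₁, ho₂, hq0, -, hq1, -, hq2, h22, -, -, -⟩ := h.orders hroot
  obtain ⟨hl0, hl1, hl2, hl3, hl4, hl5, hl6, hl7⟩ := h.ledger hroot ho₀ ho₁ ho₂
  obtain ⟨o₃, ho₃, -, -⟩ := NoJump.order_lt_two_mul hroot W (t + 3)
  have hod₃ := order_eq_of_plateau hroot W ho₃ h.shade₃
  have hdeg₃ := degree_r_succ W (t + 2) ho₂
  rw [show t + 2 + 1 = t + 3 from rfl] at hdeg₃
  have hkept := kept_degree_of_untranslated W (t + 2) hb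
  -- a witness `m` of `F_{t+2}` of degree `o₂` with `m l > r₂ l`
  obtain ⟨m, hm, hmdeg, hml⟩ : ∃ m : Fin 3 →₀ ℕ, coeff m (W.st (t + 2)).F ≠ 0 ∧ m.degree = o₂ ∧
      (W.st (t + 2)).r (W.j (t + 2)) < m (W.j (t + 2)) := by
    by_cases hl : W.j (t + 2) = k
    · refine ⟨_, h.cubic_witness₂ hroot, by rw [map_add, Finsupp.degree_single]; omega, ?_⟩
      rw [hl, Finsupp.add_apply, Finsupp.single_eq_same]
      omega
    · refine ⟨_, h.quartic_witness₂ hroot,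
        by rw [map_add, map_add, Finsupp.degree_single, Finsupp.degree_single]; omega, ?_⟩
      rcases fin3_cases h.ne h.ki h.kj (W.j (t + 2)) with hl' | hl' | hl'
      · rw [hl', Finsupp.add_apply, Finsupp.add_apply, Finsupp.single_eq_same, Finsupp.single_eq_of_ne h.ne]
        omega
      · rw [hl', Finsupp.add_apply, Finsupp.add_apply, Finsupp.single_eq_of_ne h.ne.symm, Finsupp.single_eq_same]
        omega
      · exact absurd hl' hl
  have hmem : m ∈ (W.st (t + 2)).F.support := mem_support_iff.mpr hm
  have hP : ¬ IsPthPowerExponent q (chartExponent q (W.j (t + 2)) m) :=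
    not_isPthPowerExponent_of_coord (W.j (t + 2)) (by rw [chartExponent_self]; omega)
      (by rw [chartExponent_self]; omega)
  have hc : coeff (chartExponent q (W.j (t + 2)) m) (W.st (t + 3)).F ≠ 0 := by
    rw [coeff_succ_of_untranslated hroot W (t + 2) hb hmem hP]
    exact hm
  have hle := le_degree_of_coeff_ne_zero ho₃ hc
  have hce := degree_chartExponent_add q (W.j (t + 2)) (m := m) (le_degree_of_mem_support hroot W (t + 2) hmem)
  omega

/-- THE RESIDUAL LAYER OF MOVE `t+2` (support facts): every exponent `E` of `R = resLayer_{l}(F_{t+2}, o_{t+2})` is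
off `u_l`, has `|E| ≤ 3`, and — by the cubic face of `F_{t+2}` — if its lift `E + (3 − |E|) e_l` is off the face
`u_{j_t}` then the lift IS `3 e_k`. [new] [folklore] -/
theorem res_support (hroot : IsRoot q s₀) (h : TightRepeat W t k) {o₂ : ℕ} (ho₂ : ordZero (W.st (t + 2)).F = o₂)
    {E : Fin 3 →₀ ℕ} (hE : E ∈ (resLayer (W.j (t + 2)) (W.st (t + 2)) o₂).support) :
    E (W.j (t + 2)) = 0 ∧ E.degree ≤ 3 ∧
      ((E + Finsupp.single (W.j (t + 2)) (3 - E.degree)) (W.j t) = 0 →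
        E + Finsupp.single (W.j (t + 2)) (3 - E.degree) = Finsupp.single k 3) := by
  classical
  obtain ⟨o₀, o₁, p₂, ho₀, ho₁, hp₂, -⟩ := h.orders hroot
  have e2 : o₂ = p₂ := by have := hp₂.symm.trans ho₂; exact_mod_cast this.symm
  subst e2
  obtain ⟨hl0, hl1, hl2, hl3, hl4, hl5, hl6, hl7⟩ := h.ledger hroot ho₀ ho₁ ho₂
  have hc := mem_support_iff.mp hE
  have hEl : E (W.j (t + 2)) = 0 := by
    by_contra hne
    exact hc (coeff_resLayer_eq_zero_of_ne _ _ _ hne)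
  have hdeg : E.degree ≤ 3 := by
    have := degree_le_of_coeff_resLayer_ne_zero (W.j (t + 2)) (W.st (t + 2)) (walk_r hroot W (t + 2)) o₂ hc
    omega
  refine ⟨hEl, hdeg, fun hface => ?_⟩
  set m := E + Finsupp.single (W.j (t + 2)) (3 - E.degree) with hm
  have hupd : m.update (W.j (t + 2)) 0 = E := by
    ext x
    rw [update_apply']
    split_ifs with hx
    · rw [hx, hEl]
    · rw [hm, Finsupp.add_apply, Finsupp.single_eq_of_ne hx, add_zero]
  have hmd : m.degree + (W.st (t + 2)).r.degree = o₂ := by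
    rw [hm, map_add, Finsupp.degree_single]; omega
  have hcm : coeff ((W.st (t + 2)).r + m) (W.st (t + 2)).F ≠ 0 := by
    rw [← coeff_resLayer (W.j (t + 2)) (W.st (t + 2)) (walk_r hroot W (t + 2)) o₂ m hmd, hupd]
    exact hc
  have hface₂ := h.face₂ hroot ho₂ (mem_support_iff.mpr hcm) (by rw [map_add]; omega)
    (by rw [Finsupp.add_apply, hface, add_zero])
  exact add_left_cancel hface₂

/-- The witnesses read in the residual layer of move `t+2`: `coeff_{m[l↦0]} R = coeff_{r_{t+2} + m} F_{t+2}` for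
`|m| = 3`. [folklore] -/
theorem coeff_res (hroot : IsRoot q s₀) (h : TightRepeat W t k) {o₂ : ℕ} (ho₂ : ordZero (W.st (t + 2)).F = o₂)
    (m : Fin 3 →₀ ℕ) (hm : m.degree = 3) :
    coeff (m.update (W.j (t + 2)) 0) (resLayer (W.j (t + 2)) (W.st (t + 2)) o₂) =
      coeff ((W.st (t + 2)).r + m) (W.st (t + 2)).F := by
  obtain ⟨o₀, o₁, p₂, ho₀, ho₁, hp₂, -⟩ := h.orders hroot
  have e2 : o₂ = p₂ := by have := hp₂.symm.trans ho₂; exact_mod_cast this.symm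
  subst e2
  obtain ⟨hl0, hl1, hl2, hl3, hl4, hl5, hl6, hl7⟩ := h.ledger hroot ho₀ ho₁ ho₂
  exact coeff_resLayer (W.j (t + 2)) (W.st (t + 2)) (walk_r hroot W (t + 2)) o₂ m (by omega)

/-- The residual form of move `t+2` is a cubic FORM (cone law; plateau `t+2 → t+3`). [folklore] -/
theorem cone₂ (hroot : IsRoot q s₀) (h : TightRepeat W t k) {o₂ : ℕ} (ho₂ : ordZero (W.st (t + 2)).F = o₂) :
    (resForm W (t + 2) o₂).IsHomogeneous 3 := by
  obtain ⟨o₀, o₁, p₂, ho₀, ho₁, hp₂, -, -, -, -, hq2, -⟩ := h.orders hroot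
  have e2 : o₂ = p₂ := by have := hp₂.symm.trans ho₂; exact_mod_cast this.symm
  subst e2
  exact (cone_of_plateau hroot W (t + 2) ho₂ hq2 h.plat₂ h.shade₂).1

/-- A product over `Fin 3` along the three named indices. [folklore] -/
theorem prod_three {M : Type} [CommMonoid M] {a c k' : Fin 3} (hac : a ≠ c) (hka : k' ≠ a) (hkc : k' ≠ c)
    (f : Fin 3 → M) : ∏ x, f x = f a * f c * f k' := by
  rw [Fin.prod_univ_three]
  have fin3_enum : ∀ c : Fin 3, c = 0 ∨ c = 1 ∨ c = 2 := by decide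
  rcases fin3_enum a with rfl | rfl | rfl <;> rcases fin3_enum c with rfl | rfl | rfl <;>
    rcases fin3_enum k' with rfl | rfl | rfl <;>
    first | exact absurd rfl hac | exact absurd rfl hka | exact absurd rfl hkc |
      simp only [mul_comm, mul_left_comm, mul_assoc]

/-- CHART `j_t`: the witness `u_i^2 u_j` becomes the monomial `u_i^2` of degree 2 of the cubic form `N_{t+2}`. [new]
[folklore] -/
theorem chart_j_false (hroot : IsRoot q s₀) (h : TightRepeat W t k) (hl : W.j (t + 2) = W.j t) : False := by
  classical
  obtain ⟨o₀, o₁, o₂, ho₀, ho₁, ho₂, -⟩ := h.orders hroot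
  set R := resLayer (W.j (t + 2)) (W.st (t + 2)) o₂ with hR
  have hN : coeff (Finsupp.single (W.j (t + 1)) 2) (resForm W (t + 2) o₂) = 0 :=
    (h.cone₂ hroot ho₂).coeff_eq_zero (by rw [Finsupp.degree_single]; decide)
  -- the witness in `R`
  have hw : coeff (Finsupp.single (W.j (t + 1)) 2) R ≠ 0 := by
    have hupd : (Finsupp.single (W.j (t + 1)) 2 + Finsupp.single (W.j t) 1).update (W.j (t + 2)) 0 =
        Finsupp.single (W.j (t + 1)) 2 := by
      ext x
      rw [update_apply', hl, Finsupp.add_apply]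
      split_ifs with hx
      · rw [hx, Finsupp.single_eq_of_ne h.ne.symm]
      · rw [Finsupp.single_eq_of_ne hx, add_zero]
    rw [hR, ← hupd, h.coeff_res hroot ho₂ _ (by rw [map_add, Finsupp.degree_single, Finsupp.degree_single]),
      ← add_assoc]
    exact h.quartic_witness₂ hroot
  -- the Taylor coefficient localises to that single term
  have hN' : coeff (Finsupp.single (W.j (t + 1)) 2) (translate (W.b (t + 2)) R) = 0 := hN
  rw [coeff_translate_eq_sum, Finset.sum_eq_single (Finsupp.single (W.j (t + 1)) 2)] at hN'
  · refine (mul_ne_zero hw ?_) hN'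
    rw [Finset.prod_eq_one]
    · exact one_ne_zero
    · intro x _
      rw [Nat.sub_self, pow_zero, mul_one, Nat.choose_self, Nat.cast_one]
  · intro E hE hne
    obtain ⟨hEl, hEd, hface⟩ := h.res_support hroot ho₂ hE
    by_cases hlt : E (W.j (t + 1)) < 2
    · rw [Finset.prod_eq_zero (Finset.mem_univ (W.j (t + 1)))]
      · rw [mul_zero]
      · rw [Finsupp.single_eq_same, Nat.choose_eq_zero_of_lt hlt, Nat.cast_zero, zero_mul]
    · exfalso
      push Not at hlt
      rw [hl] at hEl hface
      have hEdeg := degree_eq_three E h.ne h.ki h.kj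
      by_cases hd3 : E.degree = 3
      · have hf := hface (by rw [Finsupp.add_apply, hEl, hd3, Nat.sub_self, Finsupp.single_zero,
          Finsupp.zero_apply]; rfl)
        have := congrArg (fun f : Fin 3 →₀ ℕ => f (W.j (t + 1))) hf
        simp only [Finsupp.add_apply, Finsupp.single_eq_of_ne h.ne, Finsupp.single_eq_of_ne h.ki.symm,
          add_zero] at this
        omega
      · apply hne
        ext x
        rcases fin3_cases h.ne h.ki h.kj x with hx | hx | hx <;> rw [hx]
        · rw [Finsupp.single_eq_same]; omega
        · rw [Finsupp.single_eq_of_ne h.ne.symm]; exact hEl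
        · rw [Finsupp.single_eq_of_ne h.ki]; omega
  · intro hnot
    have h0 : coeff (Finsupp.single (W.j (t + 1)) 2) R = 0 := by rwa [mem_support_iff, not_not] at hnot
    rw [h0, zero_mul]

end TightRepeat

end LawJ2Charts

end Summit.ResolutionOfSingularities.ResolutionOfSingularities.Theorems.TightCut
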